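import Literature.NumberTheory.LFunctions.AndersonStarkContourLimit
import Literature.NumberTheory.LFunctions.AndersonStarkLeftLine
import Literature.NumberTheory.LFunctions.MertensOneSided
import Literature.NumberTheory.LFunctions.LiouvilleGaussianExplicitInequalityLower
import Literature.NumberTheory.LFunctions.LiouvilleOneSidedRH
import HarnessLib

/-!
# Proof of Anderson–Stark's Theorem 1 for `L(x)`: `liminf L(x)/√x ≤ (L(x₀) − I(x₀))/√x₀ ≤ limsup L(x)/√x`

Topic `Literature/NumberTheory/LFunctions`. Everything in this file is PROVED (no definitions).
It DISCHARGES the named fact of `Literature/NumberTheory/LFunctions/AndersonStarkLiouville.lean`: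

* `AndersonStark1981_liouville_liminf_holds : AndersonStark1981_liouville_liminf`

(the `limsup` half `AndersonStark1981_liouville_holds` is the tree's
`AndersonStarkLiouvilleHolds.lean`), i.e. the `liminf` half of Anderson–Stark's Theorem 1 (*Oscillation theorems*, LNM 899 (1981), §4) applied to Pólya's
sum `L(x) = ∑_{n ≤ x} λ(n)` with Fawaz's `I(x)` ((16)–(17)): for every `x₀ > 1` which is not an
integer (a continuity point of `L` and `I`),
`liminf L(x)/√x ≤ (L(x₀) − I(x₀))/√x₀ ≤ limsup L(x)/√x` ("The method of proof by example says
that `limsup L(x)/√x ≥ (L(x₀) − I(x₀))/√x₀` for any `x₀`"; both halves printed for `L` by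
Humphries 2013, Thm. 2.2), in the tree's `∃ᶠ`-phrasing of the two inequalities.

## The proof (Anderson–Stark §4, proof of Theorem 1, for `g = L − 1`, `G = (ζ(2w)/ζ(w) − 1)/w`)

Suppose, say, `c ≤ A(u) = e^{−u/2}L(e^u)` for all large `u` (the negation of the `liminf` claim).
1. *Landau* (tree: `LiouvilleOneSided*.lean`): the non-trivial zeros are on the line and simple,
   the residues `r_ρ = ζ(2ρ)/(ρζ'(ρ))` are bounded, `A(u)e^{−σu}` is integrable for `σ > 0` with
   Laplace transform `ζ(1+2s)/((½+s)ζ(½+s))` on `0 < Re s < ½`.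
2. *Ingham + Gaussian average + `T → ∞`* (tree: `LiouvilleGaussianExplicitInequality(Lower).lean`):
   `c ≤ Re(1/ζ(½) + ∑_ρ r_ρ e^{−εγ²} x₀^{iγ})` for every `ε > 0`.
3. *The value of the Gaussian sum* (`tendsto_re_liouvilleGaussianSum`, this file): by the residue
   theorem on `[−¾, ¼] × [−T_n, T_n]` along good heights (`AndersonStarkContour.lean`,
   `AndersonStarkHorizontal.lean`, `AndersonStarkContourLimit.lean`),
   `1/ζ(½) + e^{ε/4}/√x₀ + ∑_ρ … = (1/2π)(∫_{Re s = ¼} − ∫_{Re s = −¾}) G(s)e^{εs²}x₀^{s} dt`; on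
   `Re s = ¼` the integrand is the Laplace transform of `A`, on `Re s = −¾` it is the Laplace
   transform of `e^{−u/2}(I(e^u) − 1)` (Fawaz's evaluation of the Mellin transform of `I − 1`,
   `AndersonStarkLeftLine.lean`, `FawazLeftLine.lean`), so Anderson–Stark's Lemma 1
   (`AndersonStarkLemma1.lean`) evaluates the limit `ε → 0⁺` as `A(u₀)` and `(I(x₀) − 1)/√x₀`:
   `Re(1/ζ(½) + ∑_ρ …) → (L(x₀) − I(x₀))/√x₀`.
4. Hence `c ≤ (L(x₀) − I(x₀))/√x₀`; contrapositively the `liminf` statement, and symmetrically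
   (upper bound, `re_liouvilleGaussianSum_le_of_eventually_le`) the `limsup` statement.

## References

* [AndersonStark1981] R. J. Anderson, H. M. Stark, *Oscillation theorems*, in: Analytic Number
  Theory (Philadelphia 1980), LNM 899, Springer 1981, 79–106 — §4 Lemma 1, Theorem 1 and its proof,
  (16)–(19) and the `L`-example after (19) (read in the LNM volume,
  `lit read book:editornd-analytic-number-theory`, chunks p0055–p0061).
* [Humphries2013] P. Humphries, *The distribution of weighted sums of the Liouville function and
  Pólya's conjecture*, J. Number Theory 133 (2013), Thm. 2.2 (both halves for `L`).
-/

noncomputable section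

open Complex Filter MeasureTheory Set
open scoped Real Topology

namespace Literature.NumberTheory.LFunctions

/-! ## Continuity of `A(u) = e^{-u/2}L(e^u)` at non-integral `x₀ = e^{u₀}` -/

/-- `L` is locally constant at a non-integer `x₀ > 0`: `L(x) = L(x₀)` for `x` near `x₀`. [folklore] -/
theorem liouvilleSum_eventuallyEq_of_not_nat {x₀ : ℝ} (hx₀ : 0 < x₀) (hx₀' : ∀ n : ℕ, (n : ℝ) ≠ x₀) :
    ∀ᶠ x in 𝓝 x₀, liouvilleSum x = liouvilleSum x₀ := by
  set N : ℕ := ⌊x₀⌋₊ with hN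
  have h1 : (N : ℝ) < x₀ := lt_of_le_of_ne (Nat.floor_le hx₀.le) (hx₀' N)
  have h2 : x₀ < N + 1 := Nat.lt_floor_add_one x₀
  have hmem : Set.Ioo (N : ℝ) (N + 1) ∈ 𝓝 x₀ := Ioo_mem_nhds h1 h2
  filter_upwards [hmem] with x hx
  have hfl : ⌊x⌋₊ = N := by
    rw [Nat.floor_eq_iff (by linarith [hx.1, (N.cast_nonneg : (0 : ℝ) ≤ N)])]
    exact ⟨hx.1.le, hx.2⟩
  rw [liouvilleSum_eq_liouvilleSum_floor x, liouvilleSum_eq_liouvilleSum_floor x₀, hfl, hN]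

/-- `A` is continuous at `u₀ = log x₀` for non-integral `x₀ > 0`. [folklore] -/
theorem continuousAt_normalizedLiouville {x₀ : ℝ} (hx₀ : 0 < x₀) (hx₀' : ∀ n : ℕ, (n : ℝ) ≠ x₀) :
    ContinuousAt normalizedLiouville (Real.log x₀) := by
  unfold normalizedLiouville
  refine ContinuousAt.mul ?_ (by fun_prop)
  have hev := liouvilleSum_eventuallyEq_of_not_nat hx₀ hx₀'
  have hexp : Tendsto Real.exp (𝓝 (Real.log x₀)) (𝓝 x₀) := by
    have := Real.continuous_exp.tendsto (Real.log x₀)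
    rwa [Real.exp_log hx₀] at this
  have h2 : ∀ᶠ u in 𝓝 (Real.log x₀), (liouvilleSum (Real.exp u) : ℝ) = liouvilleSum x₀ := by
    filter_upwards [hexp.eventually hev] with u hu
    exact_mod_cast hu
  refine (continuousAt_const (y := ((liouvilleSum x₀ : ℤ) : ℝ))).congr_of_eventuallyEq ?_
  filter_upwards [h2] with u hu
  rw [hu]

/-! ## Integrability on the vertical lines -/

/-- A continuous function bounded by `M` times the Gaussian kernel `e^{ε(a+it)²}e^{(a+it)u₀}` is
integrable in `t`. [folklore] -/
theorem integrable_mul_gaussKernel_of_norm_le {φ : ℝ → ℂ} (hφ : Continuous φ) {M : ℝ}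
    (hM : ∀ t, ‖φ t‖ ≤ M) {ε : ℝ} (hε : 0 < ε) (a u₀ : ℝ) :
    Integrable fun t : ℝ ↦ φ t * (cexp (ε * ((a : ℂ) + t * I) ^ 2) * cexp (((a : ℂ) + t * I) * u₀)) := by
  have hg : Integrable fun t : ℝ ↦ M * (Real.exp (ε * a ^ 2 + a * u₀) * Real.exp (-ε * t ^ 2)) :=
    ((integrable_exp_neg_mul_sq hε).const_mul _).const_mul _
  refine hg.mono' (by fun_prop) (Eventually.of_forall fun t ↦ ?_)
  rw [norm_mul, norm_gaussKernel, neg_mul]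
  exact mul_le_mul_of_nonneg_right (hM t) (by positivity)

/-- The norm of an absolutely convergent Laplace transform is bounded by the `L¹` norm of the
damped function, uniformly on the line. [folklore] -/
private theorem norm_laplace_le' (f : ℝ → ℂ) (σ t : ℝ) :
    ‖∫ u : ℝ, f u * cexp (-(((σ : ℂ) + t * I) * u))‖ ≤ ∫ u : ℝ, ‖f u * (Real.exp (-(σ * u)) : ℂ)‖ := by
  refine (MeasureTheory.norm_integral_le_integral_norm _).trans (le_of_eq ?_)
  refine integral_congr_ae (ae_of_all _ fun u ↦ ?_)
  simp only [norm_mul, Complex.norm_exp, Complex.norm_real, Real.norm_eq_abs, Real.abs_exp]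
  congr 1
  congr 1
  simp [Complex.mul_re]


/-! ## The left line (local copies of `FawazLeftLine.lean`, to keep this file's imports in the tree) -/

/-- **Absolute convergence on the left line**: for `−1 < σ < −½`,
`u ↦ e^{−u/2}(I(e^u) − 1) · e^{−σu}` is integrable on `ℝ` (the substitution `x = e^u` in the
absolutely convergent Mellin transform of `I − 1` at `−½ − σ ∈ (0, ½)`).
[cite: AndersonStark1981, §4 (19) ff.] -/
private theorem fawazLeft_integrable {σ : ℝ} (hσ0 : -1 < σ) (hσ1 : σ < -(1 / 2)) :
    Integrable fun u : ℝ ↦ (((Real.exp (-(u / 2)) * (fawazI (Real.exp u) - 1) : ℝ)) : ℂ) *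
      (Real.exp (-(σ * u)) : ℂ) := by
  set c : ℝ := -(1 / 2) - σ with hc
  have hc0 : 0 < c := by rw [hc]; linarith
  have hc1 : c < 1 / 2 := by rw [hc]; linarith
  have hM := mellinConvergent_fawazI_sub_one (s := (c : ℂ)) (by simpa using hc0) (by simpa using hc1)
  rw [MellinConvergent, integrableOn_Ioi_iff_integrable_exp] at hM
  refine hM.congr (ae_of_all _ fun u ↦ ?_)
  simp only [smul_eq_mul, Complex.real_smul]
  rw [ofReal_exp_cpow]
  have e : (Real.exp u : ℂ) * cexp ((u : ℂ) * ((c : ℂ) - 1)) =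
      (Real.exp (-(u / 2)) : ℂ) * (Real.exp (-(σ * u)) : ℂ) := by
    rw [Complex.ofReal_exp, Complex.ofReal_exp, Complex.ofReal_exp, ← Complex.exp_add,
      ← Complex.exp_add]
    congr 1
    simp only [hc]
    push_cast
    ring
  calc (Real.exp u : ℂ) * (cexp ((u : ℂ) * ((c : ℂ) - 1)) * (((fawazI (Real.exp u) - 1 : ℝ)) : ℂ))
      = ((Real.exp u : ℂ) * cexp ((u : ℂ) * ((c : ℂ) - 1))) * (((fawazI (Real.exp u) - 1 : ℝ)) : ℂ) := by
        ring
    _ = (((Real.exp (-(u / 2)) * (fawazI (Real.exp u) - 1) : ℝ)) : ℂ) * (Real.exp (-(σ * u)) : ℂ) := by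
        rw [e]; push_cast; ring

/-- **The left line**: for `−1 < σ < −½` and all real `t`, with `s = σ + it`,
`∫_ℝ e^{−u/2}(I(e^u) − 1) e^{−su} du = ζ(1+2s)/((½+s)ζ(½+s))` — Fawaz's Mellin evaluation
`mellin (I−1) z = ζ(−2z)/(−zζ(−z))` at `z = −½ − s` after `x = e^u`.
[cite: AndersonStark1981, §4 Theorem 1 (proof), (16)–(17), (19)] -/
private theorem fawazLeft_laplace {σ : ℝ} (hσ0 : -1 < σ) (hσ1 : σ < -(1 / 2)) (t : ℝ) :
    ∫ u : ℝ, (((Real.exp (-(u / 2)) * (fawazI (Real.exp u) - 1) : ℝ)) : ℂ) *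
        cexp (-(((σ : ℂ) + t * I) * u)) =
      riemannZeta (1 + 2 * ((σ : ℂ) + t * I)) /
        ((1 / 2 + ((σ : ℂ) + t * I)) * riemannZeta (1 / 2 + ((σ : ℂ) + t * I))) := by
  set s : ℂ := (σ : ℂ) + t * I with hs
  set z : ℂ := -(1 / 2) - s with hz
  have hz0 : 0 < z.re := by simp [hz, hs]; linarith
  have hz1 : z.re < 1 / 2 := by simp [hz, hs]; linarith
  have hM := mellin_fawazI_sub_one hz0 hz1
  rw [show 2 * -z = 1 + 2 * s by rw [hz]; ring, show -z = 1 / 2 + s by rw [hz]; ring] at hM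
  rw [← hM, mellin, integral_Ioi_eq_integral_exp]
  refine integral_congr_ae (ae_of_all _ fun u ↦ ?_)
  simp only [smul_eq_mul, Complex.real_smul]
  rw [ofReal_exp_cpow]
  have e : (Real.exp u : ℂ) * cexp ((u : ℂ) * (z - 1)) =
      (Real.exp (-(u / 2)) : ℂ) * cexp (-(s * u)) := by
    rw [Complex.ofReal_exp, Complex.ofReal_exp, ← Complex.exp_add, ← Complex.exp_add]
    congr 1
    rw [hz]
    push_cast
    ring
  calc (((Real.exp (-(u / 2)) * (fawazI (Real.exp u) - 1) : ℝ)) : ℂ) * cexp (-(s * u))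
      = ((Real.exp (-(u / 2)) : ℂ) * cexp (-(s * u))) * (((fawazI (Real.exp u) - 1 : ℝ)) : ℂ) := by
        push_cast; ring
    _ = (Real.exp u : ℂ) * (cexp ((u : ℂ) * (z - 1)) * (((fawazI (Real.exp u) - 1 : ℝ)) : ℂ)) := by
        rw [← e]; ring

/-- The left-line function is continuous at every `u₀` (`I` is continuous on `(0, ∞)`), also after
the weight `e^{−σu}`. [folklore] -/
private theorem fawazLeft_continuousAt (σ u₀ : ℝ) :
    ContinuousAt (fun u : ℝ ↦ (((Real.exp (-(u / 2)) * (fawazI (Real.exp u) - 1) : ℝ)) : ℂ) *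
      (Real.exp (-(σ * u)) : ℂ)) u₀ := by
  have hI : ContinuousAt (fun u : ℝ ↦ fawazI (Real.exp u)) u₀ :=
    (continuousAt_fawazI (Real.exp_pos u₀)).comp (Real.continuous_exp.continuousAt)
  have h1 : ContinuousAt (fun u : ℝ ↦ Real.exp (-(u / 2)) * (fawazI (Real.exp u) - 1)) u₀ :=
    (by fun_prop : ContinuousAt (fun u : ℝ ↦ Real.exp (-(u / 2))) u₀).mul (hI.sub continuousAt_const)
  exact (Complex.continuous_ofReal.continuousAt.comp h1).mul (by fun_prop)


/-! ## The limit formula `lim_{ε→0⁺} Re(1/ζ(½) + ∑_ρ r_ρe^{−εγ²}x₀^{iγ}) = (L(x₀) − I(x₀))/√x₀` -/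

/-- **Anderson–Stark's evaluation of the Gaussian-damped sum** (proof of Theorem 1 for the
`L`-example: residue theorem, `T → ∞`, and Lemma 1 on both lines, `ε → 0⁺`). Under a one-sided
bound `ηL(x) ≤ A√x` (`x ≥ x₁`, `η = ±1`) — so that all non-trivial zeros are on the line and simple
and the Gaussian sums converge absolutely — for every `x₀ > 1` which is not an integer,
`Re (1/ζ(½) + ∑_ρ ζ(2ρ)e^{−εγ²}x₀^{iγ}/(ρζ'(ρ))) → (L(x₀) − I(x₀))/√x₀` as `ε → 0⁺`.
[cite: AndersonStark1981, §4 Theorem 1 (proof) and the `L`-example after (19)] -/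
theorem tendsto_re_liouvilleGaussianSum {η A x₁ a : ℝ} (hη : η = 1 ∨ η = -1) (hA0 : 0 ≤ A)
    (hb : ∀ x, x₁ ≤ x → η * (liouvilleSum x : ℝ) ≤ A * Real.sqrt x)
    (hglob : (∀ u, normalizedLiouville u ≤ a) ∨ (∀ u, -a ≤ normalizedLiouville u))
    (hS : ∀ ε : ℝ, 0 < ε → ∀ u₀ : ℝ,
      Summable fun ρ : RHWave0.riemannZetaNontrivialZeros ↦ ‖liouvilleGaussianTerm ε u₀ ρ‖)
    {x₀ : ℝ} (hx₀ : 1 < x₀) (hx₀' : ∀ n : ℕ, (n : ℝ) ≠ x₀) :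
    Tendsto (fun ε : ℝ ↦ (1 / riemannZeta (1 / 2) +
        ∑' ρ : RHWave0.riemannZetaNontrivialZeros, liouvilleGaussianTerm ε (Real.log x₀) ρ).re)
      (𝓝[>] 0) (𝓝 (((liouvilleSum x₀ : ℝ) - fawazI x₀) / Real.sqrt x₀)) := by
  have hx0 : 0 < x₀ := by linarith
  set u₀ : ℝ := Real.log x₀ with hu₀
  have hexp : Real.exp u₀ = x₀ := Real.exp_log hx0
  -- data from the one-sided bound
  have hz : ∀ ρ : ℂ, riemannZeta ρ = 0 → 0 < ρ.re → ρ.re < 1 → ρ.re = 1 / 2 ∧ deriv riemannZeta ρ ≠ 0 :=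
    fun ρ h0 h1 h2 ↦ ⟨(liouville_oneSided_zeros hη hA0 hb h0 h1 h2).1,
      (liouville_oneSided_zeros hη hA0 hb h0 h1 h2).2.1⟩
  have hI : ∀ σ : ℝ, 1 / 2 < σ →
      IntegrableOn (fun x ↦ (liouvilleSum x : ℝ) * x ^ (-(σ + 1))) (Set.Ioi 1) :=
    fun σ hσ ↦ integrableOn_liouville_rpow_of_oneSided hη hb hσ
  obtain ⟨hint, hlap⟩ := normalizedLiouville_laplace_of_oneSided hglob
  -- the two lines: the common meromorphic function
  set G : ℂ → ℂ := fun s ↦ riemannZeta (1 + 2 * s) / ((1 / 2 + s) * riemannZeta (1 / 2 + s)) with hG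
  set fR : ℝ → ℂ := fun u ↦ (normalizedLiouville u : ℂ) with hfR
  set fL : ℝ → ℂ := fun u ↦ (((Real.exp (-(u / 2)) * (fawazI (Real.exp u) - 1) : ℝ)) : ℂ) with hfL
  have hq : (((1 / 4 : ℝ)) : ℂ) = (1 / 4 : ℂ) := by norm_num
  have hm : (((-(3 / 4) : ℝ)) : ℂ) = (-(3 / 4) : ℂ) := by norm_num
  -- Laplace transforms on the two lines
  have hlapR : ∀ t : ℝ, ∫ u : ℝ, fR u * cexp (-((((1 / 4 : ℝ) : ℂ) + t * I) * u)) =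
      G (((1 / 4 : ℝ) : ℂ) + t * I) := by
    intro t
    have h := hlap (1 / 4) t (by norm_num) (by norm_num)
    have e1 : 2 * (1 / 2 + (((1 / 4 : ℝ)) : ℂ) + t * I) = 1 + 2 * ((((1 / 4 : ℝ)) : ℂ) + t * I) := by ring
    have e2 : 1 / 2 + (((1 / 4 : ℝ)) : ℂ) + t * I = 1 / 2 + ((((1 / 4 : ℝ)) : ℂ) + t * I) := by ring
    rw [e1, e2] at h
    simpa only [hfR, hG] using h
  have hlapL : ∀ t : ℝ, ∫ u : ℝ, fL u * cexp (-((((-(3 / 4) : ℝ) : ℂ) + t * I) * u)) =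
      G (((-(3 / 4) : ℝ) : ℂ) + t * I) := by
    intro t
    exact fawazLeft_laplace (σ := -(3 / 4)) (by norm_num) (by norm_num) t
  -- integrability of the damped functions
  have hintR : Integrable fun u ↦ fR u * (Real.exp (-(1 / 4 * u)) : ℂ) := by
    have := (hint (1 / 4) (by norm_num)).ofReal (𝕜 := ℂ)
    refine this.congr (ae_of_all _ fun u ↦ ?_)
    simp [hfR]
  have hintL : Integrable fun u ↦ fL u * (Real.exp (-(-(3 / 4) * u)) : ℂ) :=
    fawazLeft_integrable (σ := -(3 / 4)) (by norm_num) (by norm_num)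
  -- continuity at `u₀`
  have hcontR : ContinuousAt (fun u ↦ fR u * (Real.exp (-(1 / 4 * u)) : ℂ)) u₀ := by
    refine ContinuousAt.mul ?_ (by fun_prop)
    exact Complex.continuous_ofReal.continuousAt.comp (continuousAt_normalizedLiouville hx0 hx₀')
  have hcontL : ContinuousAt (fun u ↦ fL u * (Real.exp (-(-(3 / 4) * u)) : ℂ)) u₀ :=
    fawazLeft_continuousAt (-(3 / 4)) u₀
  -- Lemma 1 on both lines
  have hlimR := AndersonStark1981_lemma1 hintR hcontR (1 / 4) (u₀ := u₀)
  have hlimL := AndersonStark1981_lemma1 hintL hcontL (-(3 / 4)) (u₀ := u₀)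
  -- bounds for `G` on the two lines
  have hGR : ∀ t : ℝ, ‖G (((1 / 4 : ℝ) : ℂ) + t * I)‖ ≤ ∫ u : ℝ, ‖fR u * (Real.exp (-(1 / 4 * u)) : ℂ)‖ := by
    intro t; rw [← hlapR t]; exact norm_laplace_le' fR (1 / 4) t
  have hGL : ∀ t : ℝ, ‖G (((-(3 / 4) : ℝ) : ℂ) + t * I)‖ ≤ ∫ u : ℝ, ‖fL u * (Real.exp (-(-(3 / 4) * u)) : ℂ)‖ := by
    intro t; rw [← hlapL t]; exact norm_laplace_le' fL (-(3 / 4)) t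
  -- continuity of `G` on the two lines
  have hζR : ∀ t : ℝ, riemannZeta (1 / 2 + ((((1 / 4 : ℝ)) : ℂ) + t * I)) ≠ 0 := fun t ↦
    riemannZeta_ne_zero_of_liouville_integrable hI (by norm_num)
  have hζL : ∀ t : ℝ, riemannZeta (1 / 2 + ((((-(3 / 4) : ℝ)) : ℂ) + t * I)) ≠ 0 := fun t ↦
    riemannZeta_half_add_ne_zero_of_re_le (by norm_num) (by norm_num)
  have hGcont : ∀ σ : ℝ, σ = 1 / 4 ∨ σ = -(3 / 4) → (∀ t : ℝ, riemannZeta (1 / 2 + ((σ : ℂ) + t * I)) ≠ 0) →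
      Continuous fun t : ℝ ↦ G ((σ : ℂ) + t * I) := by
    intro σ hσ hζ
    simp only [hG]
    have h1 : ∀ t : ℝ, 1 + 2 * ((σ : ℂ) + t * I) ≠ 1 := by
      intro t h
      have := congrArg Complex.re h
      simp at this
      rcases hσ with h' | h' <;> rw [h'] at this <;> norm_num at this
    have h2 : ∀ t : ℝ, (1 / 2 : ℂ) + ((σ : ℂ) + t * I) ≠ 0 := by
      intro t h
      have := congrArg Complex.re h
      simp at this
      rcases hσ with h' | h' <;> rw [h'] at this <;> norm_num at this
    have h3 : ∀ t : ℝ, (1 / 2 : ℂ) + ((σ : ℂ) + t * I) ≠ 1 := by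
      intro t h
      have := congrArg Complex.re h
      simp at this
      rcases hσ with h' | h' <;> rw [h'] at this <;> norm_num at this
    refine continuous_iff_continuousAt.2 fun t ↦ ?_
    have hc1 : ContinuousAt (fun t : ℝ ↦ riemannZeta (1 + 2 * ((σ : ℂ) + t * I))) t :=
      (differentiableAt_riemannZeta (h1 t)).continuousAt.comp
        (f := fun t : ℝ ↦ 1 + 2 * ((σ : ℂ) + t * I)) (by fun_prop)
    have hc2 : ContinuousAt (fun t : ℝ ↦ riemannZeta (1 / 2 + ((σ : ℂ) + t * I))) t :=
      (differentiableAt_riemannZeta (h3 t)).continuousAt.comp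
        (f := fun t : ℝ ↦ 1 / 2 + ((σ : ℂ) + t * I)) (by fun_prop)
    exact hc1.div (ContinuousAt.mul (by fun_prop) hc2) (mul_ne_zero (h2 t) (hζ t))
  have hcontGR := hGcont (1 / 4) (Or.inl rfl) hζR
  have hcontGL := hGcont (-(3 / 4)) (Or.inr rfl) hζL
  -- the contour identity for every `ε > 0`
  have hidentity : ∀ ε : ℝ, 0 < ε →
      I * (∫ t : ℝ, G (((1 / 4 : ℝ) : ℂ) + t * I) *
          (cexp (ε * ((((1 / 4 : ℝ)) : ℂ) + t * I) ^ 2) * cexp (((((1 / 4 : ℝ)) : ℂ) + t * I) * u₀))) -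
      I * (∫ t : ℝ, G (((-(3 / 4) : ℝ) : ℂ) + t * I) *
          (cexp (ε * ((((-(3 / 4) : ℝ)) : ℂ) + t * I) ^ 2) * cexp (((((-(3 / 4) : ℝ)) : ℂ) + t * I) * u₀))) =
      2 * π * I * (1 / riemannZeta (1 / 2) + cexp (ε * (-(1 / 2) : ℂ) ^ 2) * cexp ((-(1 / 2) : ℂ) * u₀) +
        ∑' ρ : RHWave0.riemannZetaNontrivialZeros, liouvilleGaussianTerm ε u₀ ρ) := by
    intro ε hε
    have hRint := integrable_mul_gaussKernel_of_norm_le hcontGR hGR hε (1 / 4) u₀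
    have hLint := integrable_mul_gaussKernel_of_norm_le hcontGL hGL hε (-(3 / 4)) u₀
    have key := integral_vertical_sub_eq_andersonStark hε u₀ hz ?_ ?_ (hS ε hε u₀)
    · rw [← key]
      simp only [hG]
      push_cast
      congr 2 <;> refine integral_congr_ae (ae_of_all _ fun t ↦ ?_) <;> ring
    · simp only [hG] at hRint
      push_cast at hRint
      refine hRint.congr (ae_of_all _ fun t ↦ ?_)
      simp only
      ring
    · simp only [hG] at hLint
      push_cast at hLint
      refine hLint.congr (ae_of_all _ fun t ↦ ?_)
      simp only
      ring
  -- the Gaussian sum expressed through the two line integrals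
  set WR : ℝ → ℂ := fun ε ↦ ∫ t : ℝ, (∫ u : ℝ, fR u * cexp (-((((1 / 4 : ℝ) : ℂ) + t * I) * u))) *
      (cexp (ε * ((((1 / 4 : ℝ)) : ℂ) + t * I) ^ 2) * cexp (((((1 / 4 : ℝ)) : ℂ) + t * I) * u₀)) with hWR
  set WL : ℝ → ℂ := fun ε ↦ ∫ t : ℝ, (∫ u : ℝ, fL u * cexp (-((((-(3 / 4) : ℝ) : ℂ) + t * I) * u))) *
      (cexp (ε * ((((-(3 / 4) : ℝ)) : ℂ) + t * I) ^ 2) * cexp (((((-(3 / 4) : ℝ)) : ℂ) + t * I) * u₀)) with hWL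
  have hformula : ∀ ε : ℝ, 0 < ε →
      1 / riemannZeta (1 / 2) + ∑' ρ : RHWave0.riemannZetaNontrivialZeros, liouvilleGaussianTerm ε u₀ ρ =
        (WR ε - WL ε) / (2 * π) - cexp (ε * (-(1 / 2) : ℂ) ^ 2) * cexp ((-(1 / 2) : ℂ) * u₀) := by
    intro ε hε
    have h := hidentity ε hε
    have hWR' : WR ε = ∫ t : ℝ, G (((1 / 4 : ℝ) : ℂ) + t * I) *
        (cexp (ε * ((((1 / 4 : ℝ)) : ℂ) + t * I) ^ 2) * cexp (((((1 / 4 : ℝ)) : ℂ) + t * I) * u₀)) := by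
      simp only [hWR]
      exact integral_congr_ae (ae_of_all _ fun t ↦ by simp only [hlapR t])
    have hWL' : WL ε = ∫ t : ℝ, G (((-(3 / 4) : ℝ) : ℂ) + t * I) *
        (cexp (ε * ((((-(3 / 4) : ℝ)) : ℂ) + t * I) ^ 2) * cexp (((((-(3 / 4) : ℝ)) : ℂ) + t * I) * u₀)) := by
      simp only [hWL]
      exact integral_congr_ae (ae_of_all _ fun t ↦ by simp only [hlapL t])
    rw [← hWR', ← hWL'] at h
    have hπ : (2 * π : ℂ) ≠ 0 := by exact_mod_cast (by positivity : (2 * π : ℝ) ≠ 0)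
    have hI0 : (I : ℂ) ≠ 0 := Complex.I_ne_zero
    have h' : WR ε - WL ε = 2 * π * (1 / riemannZeta (1 / 2) +
        cexp (ε * (-(1 / 2) : ℂ) ^ 2) * cexp ((-(1 / 2) : ℂ) * u₀) +
        ∑' ρ : RHWave0.riemannZetaNontrivialZeros, liouvilleGaussianTerm ε u₀ ρ) := by
      have h2 : I * (WR ε - WL ε) = I * (2 * π * (1 / riemannZeta (1 / 2) +
          cexp (ε * (-(1 / 2) : ℂ) ^ 2) * cexp ((-(1 / 2) : ℂ) * u₀) +
          ∑' ρ : RHWave0.riemannZetaNontrivialZeros, liouvilleGaussianTerm ε u₀ ρ)) := by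
        rw [mul_sub, h]; ring
      exact mul_left_cancel₀ hI0 h2
    rw [h']
    field_simp
    ring
  -- the limits of the two line integrals (Lemma 1)
  have hsq : Real.exp (-(u₀ / 2)) = 1 / Real.sqrt x₀ := by
    rw [hu₀, show -(Real.log x₀ / 2) = Real.log x₀ * (-(1 / 2)) by ring,
      ← Real.rpow_def_of_pos hx0, Real.rpow_neg hx0.le, ← Real.sqrt_eq_rpow, one_div]
  have hcancel : ∀ b : ℝ, (Real.exp (b * u₀) : ℂ) * (Real.exp (-(b * u₀)) : ℂ) = 1 := by
    intro b
    rw [← Complex.ofReal_mul, ← Real.exp_add, show b * u₀ + -(b * u₀) = 0 by ring, Real.exp_zero,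
      Complex.ofReal_one]
  have hlimR' : Tendsto WR (𝓝[>] 0) (𝓝 ((2 * π : ℂ) * (((liouvilleSum x₀ : ℝ) / Real.sqrt x₀ : ℝ) : ℂ))) := by
    have hval : (2 * π : ℂ) * (((liouvilleSum x₀ : ℝ) / Real.sqrt x₀ : ℝ) : ℂ) =
        (2 * π : ℂ) * (Real.exp (1 / 4 * u₀) : ℂ) *
          ((normalizedLiouville u₀ : ℂ) * (Real.exp (-(1 / 4 * u₀)) : ℂ)) := by
      rw [hu₀, normalizedLiouville_log hx0, ← hu₀]
      calc (2 * π : ℂ) * (((liouvilleSum x₀ : ℝ) / Real.sqrt x₀ : ℝ) : ℂ)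
          = (2 * π : ℂ) * (((liouvilleSum x₀ : ℝ) / Real.sqrt x₀ : ℝ) : ℂ) *
              ((Real.exp (1 / 4 * u₀) : ℂ) * (Real.exp (-(1 / 4 * u₀)) : ℂ)) := by
            rw [hcancel, mul_one]
        _ = (2 * π : ℂ) * (Real.exp (1 / 4 * u₀) : ℂ) *
              ((((liouvilleSum x₀ : ℝ) / Real.sqrt x₀ : ℝ) : ℂ) * (Real.exp (-(1 / 4 * u₀)) : ℂ)) := by ring
    rw [hval]
    exact hlimR
  have hlimL' : Tendsto WL (𝓝[>] 0) (𝓝 ((2 * π : ℂ) * ((((fawazI x₀ - 1) / Real.sqrt x₀ : ℝ)) : ℂ))) := by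
    have hval : (2 * π : ℂ) * ((((fawazI x₀ - 1) / Real.sqrt x₀ : ℝ)) : ℂ) =
        (2 * π : ℂ) * (Real.exp (-(3 / 4) * u₀) : ℂ) *
          ((((Real.exp (-(u₀ / 2)) * (fawazI (Real.exp u₀) - 1) : ℝ)) : ℂ) *
            (Real.exp (-(-(3 / 4) * u₀)) : ℂ)) := by
      rw [hexp, hsq]
      calc (2 * π : ℂ) * ((((fawazI x₀ - 1) / Real.sqrt x₀ : ℝ)) : ℂ)
          = (2 * π : ℂ) * ((((fawazI x₀ - 1) / Real.sqrt x₀ : ℝ)) : ℂ) *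
              ((Real.exp (-(3 / 4) * u₀) : ℂ) * (Real.exp (-(-(3 / 4) * u₀)) : ℂ)) := by
            rw [hcancel, mul_one]
        _ = (2 * π : ℂ) * (Real.exp (-(3 / 4) * u₀) : ℂ) *
              ((((1 / Real.sqrt x₀ * (fawazI x₀ - 1) : ℝ)) : ℂ) * (Real.exp (-(-(3 / 4) * u₀)) : ℂ)) := by
            push_cast; ring
    rw [hval]
    exact hlimL
  -- the limit of the residue at `−½`
  have hlimE : Tendsto (fun ε : ℝ ↦ cexp (ε * (-(1 / 2) : ℂ) ^ 2) * cexp ((-(1 / 2) : ℂ) * u₀)) (𝓝[>] 0)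
      (𝓝 ((((1 / Real.sqrt x₀ : ℝ)) : ℂ))) := by
    have h : Tendsto (fun ε : ℝ ↦ cexp (ε * (-(1 / 2) : ℂ) ^ 2) * cexp ((-(1 / 2) : ℂ) * u₀)) (𝓝 0)
        (𝓝 (cexp (((0 : ℝ) : ℂ) * (-(1 / 2) : ℂ) ^ 2) * cexp ((-(1 / 2) : ℂ) * u₀))) :=
      Continuous.tendsto (by fun_prop) 0
    have hval : cexp (((0 : ℝ) : ℂ) * (-(1 / 2) : ℂ) ^ 2) * cexp ((-(1 / 2) : ℂ) * u₀) =
        (((1 / Real.sqrt x₀ : ℝ)) : ℂ) := by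
      rw [Complex.ofReal_zero, zero_mul, Complex.exp_zero, one_mul, ← hsq,
        show (-(1 / 2) : ℂ) * u₀ = (((-(u₀ / 2) : ℝ)) : ℂ) by push_cast; ring, ← Complex.ofReal_exp]
    rw [hval] at h
    exact h.mono_left nhdsWithin_le_nhds
  -- assemble
  have hlim : Tendsto (fun ε : ℝ ↦ (WR ε - WL ε) / (2 * π) - cexp (ε * (-(1 / 2) : ℂ) ^ 2) * cexp ((-(1 / 2) : ℂ) * u₀))
      (𝓝[>] 0) (𝓝 (((2 * π : ℂ) * (((liouvilleSum x₀ : ℝ) / Real.sqrt x₀ : ℝ) : ℂ) -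
        (2 * π : ℂ) * ((((fawazI x₀ - 1) / Real.sqrt x₀ : ℝ)) : ℂ)) / (2 * π) - (((1 / Real.sqrt x₀ : ℝ)) : ℂ))) :=
    ((hlimR'.sub hlimL').div_const _).sub hlimE
  have hval : ((2 * π : ℂ) * (((liouvilleSum x₀ : ℝ) / Real.sqrt x₀ : ℝ) : ℂ) -
        (2 * π : ℂ) * ((((fawazI x₀ - 1) / Real.sqrt x₀ : ℝ)) : ℂ)) / (2 * π) - (((1 / Real.sqrt x₀ : ℝ)) : ℂ) =
      (((((liouvilleSum x₀ : ℝ) - fawazI x₀) / Real.sqrt x₀ : ℝ)) : ℂ) := by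
    have hπ : (2 * π : ℂ) ≠ 0 := by exact_mod_cast (by positivity : (2 * π : ℝ) ≠ 0)
    have hs : Real.sqrt x₀ ≠ 0 := (Real.sqrt_pos.2 hx0).ne'
    field_simp
    push_cast
    field_simp
    ring
  rw [hval] at hlim
  have hlim2 : Tendsto (fun ε : ℝ ↦ 1 / riemannZeta (1 / 2) +
      ∑' ρ : RHWave0.riemannZetaNontrivialZeros, liouvilleGaussianTerm ε u₀ ρ) (𝓝[>] 0)
      (𝓝 (((((liouvilleSum x₀ : ℝ) - fawazI x₀) / Real.sqrt x₀ : ℝ)) : ℂ)) := by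
    refine hlim.congr' ?_
    filter_upwards [self_mem_nhdsWithin] with ε hε
    exact (hformula ε hε).symm
  exact (Complex.continuous_re.tendsto _).comp hlim2

/-! ## The discharges -/

/-- Absolute convergence of the Gaussian sums under a one-sided bound in the `x`-form
(`|r_ρ| ≤ 2A − η/ζ(½)`, the tree's `liouville_oneSided_residue_le`, and `∑ 1/(1+γ²) < ∞`).
[cite: AndersonStark1981, §4 Theorem 1 (proof)] -/
theorem summable_liouvilleGaussianTerm_of_oneSided {η A x₁ : ℝ} (hη : η = 1 ∨ η = -1) (hA0 : 0 ≤ A)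
    (hb : ∀ x, x₁ ≤ x → η * (liouvilleSum x : ℝ) ≤ A * Real.sqrt x) {ε : ℝ} (hε : 0 < ε) (u₀ : ℝ) :
    Summable fun ρ : RHWave0.riemannZetaNontrivialZeros ↦ ‖liouvilleGaussianTerm ε u₀ ρ‖ := by
  set B : ℝ := 2 * A - η * (1 / riemannZeta (1 / 2)).re with hB
  have hres : ∀ ρ : RHWave0.riemannZetaNontrivialZeros, ‖liouvilleResidue ρ‖ ≤ B := by
    intro ρ
    have hρ := ρ.2
    exact liouville_oneSided_residue_le hη hA0 hb
      (ZetaZeros.riemannZetaNontrivialZeros.zeta_eq_zero hρ)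
      (ZetaZeros.riemannZetaNontrivialZeros.re_pos hρ)
      (ZetaZeros.riemannZetaNontrivialZeros.re_lt_one hρ)
  have hm : ∀ ρ : RHWave0.riemannZetaNontrivialZeros, (1 : ℝ) ≤ riemannZetaZeroOrder (ρ : ℂ) := by
    intro ρ
    have hne1 := ZetaZeros.riemannZetaNontrivialZeros.ne_one ρ.2
    have h0 : 0 < riemannZetaZeroOrder (ρ : ℂ) :=
      (riemannZetaZeroOrder_pos_iff hne1).2 (ZetaZeros.riemannZetaNontrivialZeros.zeta_eq_zero ρ.2)
    have h1 : (1 : ℤ) ≤ riemannZetaZeroOrder (ρ : ℂ) := h0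
    exact_mod_cast h1
  set M : ℝ := max 1 (1 / ε) with hM
  refine Summable.of_nonneg_of_le (fun _ ↦ norm_nonneg _) (fun ρ ↦ ?_)
    (ZetaZeroSum.summable_zeroOrder_div_one_add_sq.mul_left (B * M))
  have hBρ : 0 ≤ B := (norm_nonneg _).trans (hres ρ)
  rw [norm_liouvilleGaussianTerm]
  calc ‖liouvilleResidue ρ‖ * Real.exp (-(ε * (ρ : ℂ).im ^ 2))
      ≤ B * (M / (1 + (ρ : ℂ).im ^ 2)) :=
        mul_le_mul (hres ρ) (exp_neg_mul_sq_le hε _) (Real.exp_pos _).le hBρ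
    _ = B * M * (1 / (1 + (ρ : ℂ).im ^ 2)) := by ring
    _ ≤ B * M * ((riemannZetaZeroOrder (ρ : ℂ) : ℝ) / (1 + (ρ : ℂ).im ^ 2)) := by
        refine mul_le_mul_of_nonneg_left ?_ (by positivity)
        exact div_le_div_of_nonneg_right (hm ρ) (by positivity)

/-- From an eventual bound in `x` to the `u`-variable: if `c√x ≤ L(x)` for `x ≥ X` then
`c ≤ A(u)` for `u ≥ log(max X 1)`; dually for upper bounds. [folklore] -/
theorem normalizedLiouville_ge_of_eventually {c X : ℝ} (h : ∀ x, X ≤ x → c * Real.sqrt x ≤ (liouvilleSum x : ℝ)) :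
    ∀ u, Real.log (max X 1) ≤ u → c ≤ normalizedLiouville u := by
  intro u hu
  have hm : 0 < max X 1 := lt_of_lt_of_le one_pos (le_max_right X 1)
  have hxu : X ≤ Real.exp u := by
    have : max X 1 ≤ Real.exp u := by
      rw [← Real.exp_log hm]; exact Real.exp_le_exp.2 hu
    exact (le_max_left _ _).trans this
  have h1 := h _ hxu
  have hpos : 0 < Real.sqrt (Real.exp u) := Real.sqrt_pos.2 (Real.exp_pos u)
  have h2 := normalizedLiouville_log (Real.exp_pos u)
  rw [Real.log_exp] at h2
  rw [h2, le_div_iff₀ hpos]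
  exact h1

/-- The dual statement. [folklore] -/
theorem normalizedLiouville_le_of_eventually {c X : ℝ} (h : ∀ x, X ≤ x → (liouvilleSum x : ℝ) ≤ c * Real.sqrt x) :
    ∀ u, Real.log (max X 1) ≤ u → normalizedLiouville u ≤ c := by
  intro u hu
  have hm : 0 < max X 1 := lt_of_lt_of_le one_pos (le_max_right X 1)
  have hxu : X ≤ Real.exp u := by
    have : max X 1 ≤ Real.exp u := by
      rw [← Real.exp_log hm]; exact Real.exp_le_exp.2 hu
    exact (le_max_left _ _).trans this
  have h1 := h _ hxu
  have hpos : 0 < Real.sqrt (Real.exp u) := Real.sqrt_pos.2 (Real.exp_pos u)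
  have h2 := normalizedLiouville_log (Real.exp_pos u)
  rw [Real.log_exp] at h2
  rw [h2, div_le_iff₀ hpos]
  exact h1

/-- **Anderson–Stark 1981, Theorem 1 for `L(x)`, the `liminf` half** — discharge of the named fact
`AndersonStark1981_liouville_liminf`: for every non-integral `x₀ > 1` and every
`c > (L(x₀) − I(x₀))/√x₀`, `L(x) < c√x` for arbitrarily large `x`. Proof (Anderson–Stark §4,
"The lim inf part of the theorem again follows by simply replacing `g`, `h`, `G` by `−g`, `−h`,
`−G`"): otherwise `c ≤ A(u)` eventually; then (Landau) the zeros are on the line and simple with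
bounded residues, Ingham's theorem with Gaussian averaging gives `c ≤ Re(1/ζ(½) + ∑_ρ r_ρe^{−εγ²}x₀^{iγ})`
for every `ε > 0` (`le_re_liouvilleGaussianSum_of_eventually_ge`), and the right side tends to
`(L(x₀) − I(x₀))/√x₀` as `ε → 0⁺` (`tendsto_re_liouvilleGaussianSum`: residue theorem, good heights,
Lemma 1 on the lines `Re s = ¼` (Laplace transform of `A`) and `Re s = −¾` (Fawaz's Mellin transform
of `I − 1`)), a contradiction. [cite: AndersonStark1981, §4 Theorem 1 and the `L`-example after (19)]
[cite: Humphries2013, Theorem 2.2] -/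
theorem AndersonStark1981_liouville_liminf_holds : AndersonStark1981_liouville_liminf := by
  intro x₀ hx₀ hnat c hc
  by_contra hno
  rw [Filter.not_frequently] at hno
  obtain ⟨X, hX⟩ := eventually_atTop.1 hno
  have hX' : ∀ x, X ≤ x → c * Real.sqrt x ≤ (liouvilleSum x : ℝ) := fun x hx ↦ not_lt.1 (hX x hx)
  set u₁ : ℝ := Real.log (max X 1) with hu₁
  have hu : ∀ u, u₁ ≤ u → c ≤ normalizedLiouville u := normalizedLiouville_ge_of_eventually hX'
  -- the one-sided data
  have hb := liouvilleSum_ge_of_eventually_ge hu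
  obtain ⟨B₀, hB₀⟩ := normalizedLiouville_locally_bounded u₁
  have hglob : (∀ u, normalizedLiouville u ≤ max (-c) B₀) ∨ (∀ u, -max (-c) B₀ ≤ normalizedLiouville u) := by
    refine Or.inr fun u ↦ ?_
    rcases le_or_gt u₁ u with h | h
    · have := hu u h
      linarith [le_max_left (-c) B₀]
    · have := (abs_le.1 (hB₀ u h.le)).1
      linarith [le_max_right (-c) B₀]
  have hlim := tendsto_re_liouvilleGaussianSum (Or.inr rfl) (le_max_right _ _) hb hglob
    (fun ε hε u₀ ↦ summable_liouvilleGaussianTerm_of_oneSided (Or.inr rfl) (le_max_right _ _) hb hε u₀)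
    hx₀ hnat
  have hge : ∀ᶠ ε in 𝓝[>] (0 : ℝ), c ≤ (1 / riemannZeta (1 / 2) +
      ∑' ρ : RHWave0.riemannZetaNontrivialZeros, liouvilleGaussianTerm ε (Real.log x₀) ρ).re := by
    filter_upwards [self_mem_nhdsWithin] with ε hε
    exact le_re_liouvilleGaussianSum_of_eventually_ge hu hε (Real.log x₀)
  have := ge_of_tendsto hlim hge
  linarith

end Literature.NumberTheory.LFunctions
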